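import Mathlib
import Literature.Analysis.FluidPDE.Tao2016AveragedNS.RenormalisedCascadeWaves
import Literature.Analysis.FluidPDE.Tao2016AveragedNS.CascadeTableDictionary
import Literature.Analysis.FluidPDE.Tao2016AveragedNS.SelfSimilarCascadeBlowup
import Literature.Analysis.FluidPDE.Tao2016AveragedNS.SelfSimilarCascadeResidues
import Literature.Analysis.FluidPDE.Tao2016AveragedNS.ViscousEternalSolutions
import Literature.Analysis.FluidPDE.Tao2016AveragedNS.BoundedEternalSolutions
import Summits.NavierStokesRegularity.NavierStokesRegularity.Theorems.TaoLadderRungTwoBreakNoSurvivingEternalViscBddOneSubDyadicSpread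
import Summits.NavierStokesRegularity.NavierStokesRegularity.Theorems.WakeRatchetAdmissibleEternalBoundDyadic
import Summits.NavierStokesRegularity.NavierStokesRegularity.Theorems.WakeRatchetAdmissibleEternalBoundCritical
import Summits.NavierStokesRegularity.NavierStokesRegularity.Theorems.WakeRatchetTailRatchet.Negative.TailRatchetFalseOfDyadicScalarFronts
import HarnessLib

/-!
# Route TaoLadderRungTwoBreak — RANK-ONE (polarised) admissible eternal solutions: the scalar chain, the
# null-polarisation Liouville theorem, and «scalar chain ⟹ dyadic member»
# (`--supports` stmt-NavierStokesRegularity-20419; part 1 of 2, sibling `…RankOneShadow`)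

MODEL lattice (Tao 2016 §4) only; nothing here is a statement about the Navier–Stokes equations; no stub,
crux, rung or summit is proved by this file.

A **rank-one (polarised) family** is `W_n(σ) = c_n(σ)·v` — every shell along one fixed direction
`v ∈ ℝ^m`, `v ≠ 0`.  For ANY cancelling table `α` (condition (4.3) alone: no symmetry, no comparability,
any spread) the lattice law of `IsEternalVisc ε₀ ν̂ α` projected on `v` is the scalar chain

  `c_n' = −(1+ν̂_n) c_n + κ(v)·(Λ c_{n-1}² − Λ⁻¹ c_n c_{n+1})`,  `κ(v) = ⟪v, A(v)⟫/‖v‖²`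

(`hasDerivAt_rankOne_coeff`): the table maps are homogeneous (tree `WakeRatchetCritical.tableQ_smul`,
`tableA_smul`, `tableB_smul_smul`), intra-shell neutrality `⟪v, Q v⟫ = 0` and the type-split cancellation
`⟪v, B(v,v)⟫ = −⟪v, A v⟫` (tree `table_sTable`) leave the single structure constant `κ(v)`
(`inner_rankOne_field`).  Consequences proved here (`ε₀ > 0`, any covariant viscosity `ν̂ ≥ 0`):

* NULL polarisation `⟪v, A v⟫ = 0` ⟹ `W ≡ 0` (`rankOne_null_coeff_eq_zero`, `rankOne_null_eq_zero`,
  `rankOne_null_not_surviving`): the amplitudes are purely damped and a damped mode with integrable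
  log-time action vanishes (the ACTION clause is used — the law alone admits `c_n = C_n e^{-σ}`);
  e.g. EVERY coordinate axis of EVERY table of spread `R < 2` is null (`axis_null_of_lt_two`, from
  `SubDyadicSpread.tableA_eq_zero_of_oneMode`), so coordinate-polarised admissible eternal solutions of
  sub-dyadic tables vanish identically (`axisPolarised_eq_zero_of_lt_two`) — in contrast with the DIAGONAL
  of the spread-one twin-rotor table, an active polarisation carrying the dyadic chain (`…TwinRotorEmbedding`);
* «SCALAR CHAIN ⟹ DYADIC MEMBER» (`isEternalVisc_dyadic_of_scalar`, the converse of the tree's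
  `dyadic_hasDerivAt_apply`): a scalar family solving the renormalised Katz–Pavlović chain with the
  admissibility bounds, placed on component `0`, is an admissible eternal solution of `dyadicTable`
  (`dyadic_field_single` computes the dyadic field on `e₀`-polarised states from the tree's `qform_dyadicTable`).

The sibling file `…RankOneShadow` turns an ACTIVE polarisation into an admissible DYADIC solution (the
shadow `κ(v)c_n·e₀`) and derives, by name, that the K1-type predicates of the route at any spread govern
all rank-one solutions of all cancelling tables.  HONEST LABEL: reduction of a thin sector; every stub of
⟨20419⟩, ⟨20420⟩, ⟨20205⟩ remains OPEN.
-/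

noncomputable section

-- the sub-problem namespace repeats the summit name by design (D-0017)
set_option linter.dupNamespace false

namespace Summit.NavierStokesRegularity.NavierStokesRegularity.Theorems.TaoLadderRungTwoBreakRankOne

open Filter Topology MeasureTheory Set
open scoped RealInnerProductSpace
open Literature.Analysis.FluidPDE Literature.Analysis.FluidPDE.TaoCascade
open Summit.NavierStokesRegularity.NavierStokesRegularity.Theorems.WakeRatchetDyadic
  (hasDerivAt_dampingPrimitive)
open Summit.NavierStokesRegularity.NavierStokesRegularity.Theorems.WakeRatchetCritical
  (tableQ_smul tableA_smul tableB_smul_smul)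
open Summit.NavierStokesRegularity.NavierStokesRegularity.Theorems.WakeRatchetDyadicFront (qform_dyadicTable)
open Summit.NavierStokesRegularity.NavierStokesRegularity.Theorems.WakeRatchetFedSpike (exists_le_abs_lt)
open Summit.NavierStokesRegularity.NavierStokesRegularity.Theorems.NoSurvivingEternalViscBddOne.SubDyadicSpread
  (tableA_eq_zero_of_oneMode)


/-! ## The rank-one projection of the lattice field (homogeneity: tree `WakeRatchetCritical`) -/

section Algebra

variable {m : ℕ}

/-- **The rank-one projection of the lattice field.**  For a cancelling table and any direction `v`, the
renormalised field (damping `1`, feed `Λ`, drain `Λ⁻¹`, extra linear damping `g`) evaluated on the polarised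
states `a•v, b•v, d•v` (shell below, the shell, shell above) has `v`-component
`−(1+g)b‖v‖² + (Λa² − Λ⁻¹bd)·⟪v, A v⟫`: intra-shell neutrality kills `Q`, the type-split cancellation
`⟪v, B(v,v)⟫ = −⟪v, A v⟫` merges drain and feed into ONE structure constant.
[cite: Tao2016AveragedNS, §4 (4.3), Lemma 4.1 (4.8); tree `table_sTable`] -/
theorem inner_rankOne_field {α : Fin m → Fin m → Fin m → ℤ × ℤ × ℤ → ℝ} (hc : IsCancellingCoeff α)
    (v : Em m) (Λ g a b d : ℝ) :
    ⟪v, -((1 : ℝ) • (b • v)) + tableQ α (b • v) + Λ • tableA α (a • v)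
        + Λ⁻¹ • tableB α (d • v) (b • v) - g • (b • v)⟫
      = -((1 + g) * b) * ‖v‖ ^ 2 + (Λ * (a * a) - Λ⁻¹ * (b * d)) * ⟪v, tableA α v⟫ := by
  have hT := table_sTable α hc
  have hQ : ⟪v, tableQ α v⟫ = 0 := hT.intra v
  have hB : ⟪v, tableB α v v⟫ = -⟪v, tableA α v⟫ := by
    have h := hT.cancel v v
    linarith
  rw [tableQ_smul, tableA_smul, tableB_smul_smul]
  simp only [inner_add_right, inner_sub_right, inner_neg_right, real_inner_smul_right,
    real_inner_self_eq_norm_sq, hQ, hB]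
  ring

end Algebra

/-! ## The scalar chain of a rank-one admissible eternal solution -/

section RankOne

variable {m : ℕ} {ε₀ νh : ℝ} {α : Fin m → Fin m → Fin m → ℤ × ℤ × ℤ → ℝ}
  {W : ℤ → ℝ → Em m} {v : Em m} {c : ℤ → ℝ → ℝ}

/-- **The amplitudes of a rank-one admissible eternal solution solve the scalar chain with coupling
`κ(v) = ⟪v, A v⟫/‖v‖²`:**  `c_n' = −(1+ν̂_n)c_n + κ(v)(Λc_{n-1}² − Λ⁻¹c_nc_{n+1})` — for ANY cancelling table.
[cite: Tao2016AveragedNS, §1.2 (the dyadic model), §4 (4.3), Lemma 4.1 (4.8), the viscous equation before Thm. 4.2, §6.4; cell vocabulary (`IsEternalVisc`, `viscCoef`)] -/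
theorem hasDerivAt_rankOne_coeff (hc : IsCancellingCoeff α) (hv : v ≠ 0)
    (hWv : ∀ n σ, W n σ = c n σ • v) (hW : IsEternalVisc ε₀ νh α W) (n : ℤ) (σ : ℝ) :
    HasDerivAt (c n)
      (-(1 + viscCoef ε₀ νh n σ) * c n σ
        + ⟪v, tableA α v⟫ / ‖v‖ ^ 2
          * (bigLam ε₀ * (c (n - 1) σ * c (n - 1) σ) - (bigLam ε₀)⁻¹ * (c n σ * c (n + 1) σ))) σ := by
  have hv2 : (0 : ℝ) < ‖v‖ ^ 2 := pow_pos (norm_pos_iff.2 hv) 2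
  have hWn : W n = fun s => c n s • v := funext (hWv n)
  have hlaw : HasDerivAt (fun s => c n s • v)
      (-((1 : ℝ) • (c n σ • v)) + tableQ α (c n σ • v) + bigLam ε₀ • tableA α (c (n - 1) σ • v)
        + (bigLam ε₀)⁻¹ • tableB α (c (n + 1) σ • v) (c n σ • v)
        - (νh * ((1 + ε₀) ^ ((2 : ℝ) * n) * Real.exp (-σ))) • (c n σ • v)) σ := by
    have h := hW.law n σ
    rw [hWn] at h
    simp only [hWv] at h
    exact h
  have h1 : HasDerivAt (fun s => ⟪v, c n s • v⟫)
      (⟪v, -((1 : ℝ) • (c n σ • v)) + tableQ α (c n σ • v) + bigLam ε₀ • tableA α (c (n - 1) σ • v)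
        + (bigLam ε₀)⁻¹ • tableB α (c (n + 1) σ • v) (c n σ • v)
        - (νh * ((1 + ε₀) ^ ((2 : ℝ) * n) * Real.exp (-σ))) • (c n σ • v)⟫
        + ⟪(0 : Em m), c n σ • v⟫) σ :=
    HasDerivAt.inner ℝ (hasDerivAt_const σ v) hlaw
  rw [inner_zero_left, add_zero, inner_rankOne_field hc] at h1
  have h2 : HasDerivAt (fun s => ⟪v, c n s • v⟫ * (‖v‖ ^ 2)⁻¹) _ σ := h1.mul_const ((‖v‖ ^ 2)⁻¹)
  have hfun : (fun s => ⟪v, c n s • v⟫ * (‖v‖ ^ 2)⁻¹) = c n := by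
    funext s
    rw [real_inner_smul_right, real_inner_self_eq_norm_sq]
    field_simp
  rw [hfun] at h2
  refine h2.congr_deriv ?_
  unfold viscCoef
  field_simp

/-- The norm of a rank-one state: `‖c•v‖ = |c|‖v‖`. [elementary] -/
theorem norm_rankOne (hWv : ∀ n σ, W n σ = c n σ • v) (n : ℤ) (σ : ℝ) :
    ‖W n σ‖ = |c n σ| * ‖v‖ := by
  rw [hWv, norm_smul, Real.norm_eq_abs]

/-- **NULL POLARISATION ⟹ TRIVIAL.**  If `⟪v, A v⟫ = 0` then every rank-one admissible eternal solution
along `v` (any cancelling table, `ε₀ > 0`, any covariant viscosity `ν̂ ≥ 0`) vanishes identically: its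
amplitudes solve the pure damping `c' = −(1+ν̂_n)c`, so `c·e^{P}` is constant (`P' = 1+ν̂_n`), i.e.
`|c(s)| = |C|e^{-P(s)} ≥ |C|` for `s ≤ 0` — incompatible with the integrability of `‖W_n‖ = |c_n|‖v‖`
unless `C = 0`.  (The action clause is used; the law alone admits `c_n = C_n e^{-σ}`.)
[cite: Tao2016AveragedNS, §4 (4.3), Lemma 4.1 (4.8), the viscous equation before Thm. 4.2, §6.4; cell vocabulary (`IsEternalVisc`); adapted from tree `WakeRatchetDyadic.dyadic_apply_ne_zero`] -/
theorem rankOne_null_coeff_eq_zero (hε : 0 < ε₀) (hc : IsCancellingCoeff α) (hv : v ≠ 0)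
    (hA : ⟪v, tableA α v⟫ = 0) (hWv : ∀ n σ, W n σ = c n σ • v) (hW : IsEternalVisc ε₀ νh α W)
    (n : ℤ) (σ : ℝ) : c n σ = 0 := by
  set K : ℝ := νh * (1 + ε₀) ^ ((2 : ℝ) * n) with hKdef
  have hx : 0 < 1 + ε₀ := by linarith
  have hK : 0 ≤ K := mul_nonneg hW.nonneg (Real.rpow_nonneg hx.le _)
  set P : ℝ → ℝ := fun s => s - K * Real.exp (-s) with hPdef
  have hP : ∀ s, HasDerivAt P (1 + viscCoef ε₀ νh n s) s := fun s =>
    hasDerivAt_dampingPrimitive ε₀ νh n s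
  have hu : ∀ s, HasDerivAt (c n) (-(1 + viscCoef ε₀ νh n s) * c n s) s := by
    intro s
    have := hasDerivAt_rankOne_coeff hc hv hWv hW n s
    rw [hA, zero_div, zero_mul, add_zero] at this
    exact this
  have hφ : ∀ s, HasDerivAt (fun s => c n s * Real.exp (P s)) 0 s := by
    intro s
    have := (hu s).mul (hP s).exp
    exact this.congr_deriv (by ring)
  have hconst := is_const_of_deriv_eq_zero (f := fun s => c n s * Real.exp (P s))
    (fun s => (hφ s).differentiableAt) (fun s => (hφ s).deriv)
  set C : ℝ := c n 0 * Real.exp (P 0) with hCdef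
  have hrep : ∀ s, c n s = C * Real.exp (-(P s)) := by
    intro s
    have h1 : c n s * Real.exp (P s) = C := hconst s 0
    have h2 : Real.exp (P s) * Real.exp (-(P s)) = 1 := by rw [← Real.exp_add]; simp
    calc c n s = c n s * (Real.exp (P s) * Real.exp (-(P s))) := by rw [h2, mul_one]
      _ = C * Real.exp (-(P s)) := by rw [← mul_assoc, h1]
  -- `C = 0`, by integrability of `‖W_n‖ = |c_n| ‖v‖`
  have hC : C = 0 := by
    by_contra hC
    have hvpos : 0 < ‖v‖ := norm_pos_iff.2 hv
    have hCpos : 0 < |C| * ‖v‖ := mul_pos (abs_pos.2 hC) hvpos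
    obtain ⟨a, ha0, ha⟩ := exists_le_abs_lt (hW.action.choose_spec n).1 hCpos 0
    rw [abs_of_nonneg (norm_nonneg _), norm_rankOne hWv] at ha
    have h1 : |c n a| < |C| := lt_of_mul_lt_mul_right ha hvpos.le
    have hPa : -(P a) ≥ 0 := by
      simp only [hPdef]
      have : 0 ≤ K * Real.exp (-a) := mul_nonneg hK (Real.exp_pos _).le
      linarith
    have h2 : |C| ≤ |c n a| :=
      calc |C| ≤ |C| * Real.exp (-(P a)) :=
            le_mul_of_one_le_right (abs_nonneg C) (Real.one_le_exp hPa)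
        _ = |c n a| := by
            rw [hrep a, abs_mul C (Real.exp (-(P a))), abs_of_pos (Real.exp_pos _)]
    linarith
  rw [hrep σ, hC, zero_mul]

/-- **NULL POLARISATION ⟹ `W ≡ 0`.** [cite: Tao2016AveragedNS, §4 (4.3), Lemma 4.1 (4.8), §6.4; cell vocabulary (`IsEternalVisc`)] -/
theorem rankOne_null_eq_zero (hε : 0 < ε₀) (hc : IsCancellingCoeff α) (hv : v ≠ 0)
    (hA : ⟪v, tableA α v⟫ = 0) (hWv : ∀ n σ, W n σ = c n σ • v) (hW : IsEternalVisc ε₀ νh α W)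
    (n : ℤ) (σ : ℝ) : W n σ = 0 := by
  rw [hWv, rankOne_null_coeff_eq_zero hε hc hv hA hWv hW n σ, zero_smul]

/-- The zero family is not forward (S_a)-surviving, for any `a`. [cite: Tao2016AveragedNS, §4 (the viscous equation before Thm. 4.2); cell vocabulary (`EternalSurvivingFwd`)] -/
theorem not_eternalSurvivingFwd_of_eq_zero {a : ℝ} {W : ℤ → ℝ → Em m} (h0 : ∀ n σ, W n σ = 0) :
    ¬ EternalSurvivingFwd a ε₀ W := by
  rintro ⟨c, hc, H⟩
  obtain ⟨n, -, σ, -, hle⟩ := H 0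
  rw [h0, norm_zero] at hle
  simp at hle
  linarith

/-- **NULL POLARISATION ⟹ NOT SURVIVING** (any exponent `a`). [cite: Tao2016AveragedNS, §4 (4.3), Lemma 4.1 (4.8), §6.4; cell vocabulary] -/
theorem rankOne_null_not_surviving {a : ℝ} (hε : 0 < ε₀) (hc : IsCancellingCoeff α) (hv : v ≠ 0)
    (hA : ⟪v, tableA α v⟫ = 0) (hWv : ∀ n σ, W n σ = c n σ • v) (hW : IsEternalVisc ε₀ νh α W) :
    ¬ EternalSurvivingFwd a ε₀ W :=
  not_eternalSurvivingFwd_of_eq_zero (rankOne_null_eq_zero hε hc hv hA hWv hW)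

/-- **Every coordinate axis of a table below the dyadic spread is a NULL polarisation**: for
`α ∈ E₂(R)`, `0 < R < 2`, `⟪e_b, A e_b⟫ = 0` (indeed `A(e_b) = 0`: no square monomials,
`SubDyadicSpread.tableA_eq_zero_of_oneMode`).
[cite: Tao2016AveragedNS, §4 (4.2)–(4.3), §6.1; tree `SubDyadicSpread.tableA_eq_zero_of_oneMode`] -/
theorem axis_null_of_lt_two {R : ℝ} (hα : InTableClass R α) (hR0 : 0 < R) (hR : R < 2) (b : Fin m) :
    ⟪EuclideanSpace.single b (1 : ℝ), tableA α (EuclideanSpace.single b (1 : ℝ))⟫ = 0 := by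
  rw [tableA_eq_zero_of_oneMode hα hR0 hR (b := b) (fun j hj => by simp [hj]), inner_zero_right]

/-- **Coordinate-polarised admissible eternal solutions of a sub-dyadic table vanish identically**
(`α ∈ E₂(R)`, `0 < R < 2`, `ε₀ > 0`, any `ν̂ ≥ 0`, every shell along the same axis `e_b`).  Contrast: the
DIAGONAL `(1,1,0,0)` of the spread-one twin-rotor table is an active polarisation carrying the full dyadic
chain (sibling file `…TwinRotorEmbedding`).
[cite: Tao2016AveragedNS, §4 (4.2)–(4.3), Lemma 4.1 (4.8), §6.1, §6.4; cell vocabulary] -/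
theorem axisPolarised_eq_zero_of_lt_two {R : ℝ} (hε : 0 < ε₀) (hα : InTableClass R α) (hR0 : 0 < R)
    (hR : R < 2) {b : Fin m} (hWv : ∀ n σ, W n σ = c n σ • EuclideanSpace.single b (1 : ℝ))
    (hW : IsEternalVisc ε₀ νh α W) (n : ℤ) (σ : ℝ) : W n σ = 0 :=
  rankOne_null_eq_zero hε hα.2.1 (by simp) (axis_null_of_lt_two hα hR0 hR b) hWv hW n σ

end RankOne

/-! ## Scalar chains ARE the dyadic member (the converse of `dyadic_hasDerivAt_apply`) -/

section Dyadic

variable {ε₀ νh : ℝ}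

/-- **The dyadic lattice field on `e₀`-polarised states** is the Katz–Pavlović field:
`(−(1+g)b + Λa² − Λ⁻¹bd)·e₀`. [cite: Tao2016AveragedNS, §1.2 (dyadic model), §4 Lemma 4.1 (4.8), §6.4; cell vocabulary (`dyadicTable`)] -/
theorem dyadic_field_single (Λ g a b d : ℝ) :
    -((1 : ℝ) • (b • EuclideanSpace.single (0 : Fin 4) (1 : ℝ)))
        + tableQ dyadicTable (b • EuclideanSpace.single (0 : Fin 4) (1 : ℝ))
        + Λ • tableA dyadicTable (a • EuclideanSpace.single (0 : Fin 4) (1 : ℝ))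
        + Λ⁻¹ • tableB dyadicTable (d • EuclideanSpace.single (0 : Fin 4) (1 : ℝ))
            (b • EuclideanSpace.single (0 : Fin 4) (1 : ℝ))
        - g • (b • EuclideanSpace.single (0 : Fin 4) (1 : ℝ))
      = (-(1 + g) * b + (Λ * (a * a) - Λ⁻¹ * (b * d))) • EuclideanSpace.single (0 : Fin 4) (1 : ℝ) := by
  ext i
  simp only [PiLp.add_apply, PiLp.sub_apply, PiLp.neg_apply, PiLp.smul_apply, smul_eq_mul,
    tableQ_apply, tableA_apply, tableB_apply, qform_dyadicTable, PiLp.single_apply]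
  fin_cases i
  · simp [dyadicTable]; ring
  all_goals simp

/-- `‖u•e_b‖ = |u|` for a coordinate axis `e_b` of `ℝ⁴`. [elementary] -/
theorem norm_smul_axis (b : Fin 4) (u : ℝ) : ‖u • EuclideanSpace.single b (1 : ℝ)‖ = |u| := by
  rw [norm_smul, PiLp.norm_single, norm_one, mul_one, Real.norm_eq_abs]

/-- **SCALAR CHAIN ⟹ ADMISSIBLE DYADIC SOLUTION.**  A scalar family `u_n(σ)` solving the renormalised
Katz–Pavlović chain `u_n' = −(1+ν̂_n)u_n + Λu_{n-1}² − Λ⁻¹u_nu_{n+1}` (`ν̂ ≥ 0`) with a uniform per-shell action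
bound and per-shell forward energy bounds IS, placed on component `0`, an admissible eternal solution of
`dyadicTable` with covariant viscosity `ν̂` (the converse of the tree's `dyadic_hasDerivAt_apply`).
[cite: Tao2016AveragedNS, §1.2 (dyadic model), §4 Lemma 4.1 (4.8), the viscous equation before Thm. 4.2, §6.4; cell vocabulary (`IsEternalVisc`, `dyadicTable`)] -/
theorem isEternalVisc_dyadic_of_scalar {u : ℤ → ℝ → ℝ} (hν : 0 ≤ νh)
    (hlaw : ∀ (n : ℤ) (σ : ℝ), HasDerivAt (u n)
      (-(1 + viscCoef ε₀ νh n σ) * u n σ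
        + (bigLam ε₀ * (u (n - 1) σ * u (n - 1) σ) - (bigLam ε₀)⁻¹ * (u n σ * u (n + 1) σ))) σ)
    (hact : ∃ M : ℝ, ∀ n : ℤ, Integrable (fun σ => |u n σ|) ∧ ∫ σ, |u n σ| ≤ M)
    (hbdd : ∀ n : ℤ, ∃ σ₀ P : ℝ, ∀ σ, σ₀ ≤ σ → Real.exp (2 * σ) * (u n σ) ^ 2 ≤ P) :
    IsEternalVisc ε₀ νh dyadicTable (fun n σ => u n σ • EuclideanSpace.single (0 : Fin 4) (1 : ℝ)) where
  law n σ := by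
    have h := (hlaw n σ).smul_const (EuclideanSpace.single (0 : Fin 4) (1 : ℝ))
    rw [dyadic_field_single]
    refine h.congr_deriv ?_
    unfold viscCoef
    ring_nf
  nonneg := hν
  action := by
    obtain ⟨M, hM⟩ := hact
    refine ⟨M, fun n => ?_⟩
    have hfun : (fun σ => ‖u n σ • EuclideanSpace.single (0 : Fin 4) (1 : ℝ)‖) = fun σ => |u n σ| := by
      funext σ; exact norm_smul_axis 0 _
    simp only [hfun]
    exact hM n
  bdd n := by
    obtain ⟨σ₀, P, hP⟩ := hbdd n
    refine ⟨σ₀, P, fun σ hσ => ?_⟩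
    rw [norm_smul_axis, sq_abs]
    exact hP σ hσ

end Dyadic

end Summit.NavierStokesRegularity.NavierStokesRegularity.Theorems.TaoLadderRungTwoBreakRankOne

end
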